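import Summits.ABC.IUTFork.LanaRssChecks
import Summits.ABC.IUTFork.Cor312VolumesSummands
import Summits.ABC.IUTFork.Cor312TeamAGapWitness
import HarnessLib

/-!
# Fork skeleton SCHEMA rows F-1913 / F-2623 — ∀-closures REFUTED, instances INHABITED

PROOF-ONLY companion (0 `def`, 0 `instance`, 0 notation; junk variants built inside theorem terms) of the abc-iut cell, block F
(seat abc-iut-f-130, gen 7; director-abc g4 ROW SUPPLY `ROWS-LF-0348.tsv` «decide the label»), sequel to
`ForkSkeletonSchemaClosures{,B,C,D,E,F}.lean`. It imports — never edits — `LanaRssBridge` (`EtaData.SuitableInHull`, LANA §8.1 (f)) with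
the cell's measure-theoretic toy `LanaRssChecks` (`RssChecks.strictModel`, `ptRegion`, `allRegion` on the two-point counting measure),
`Cor312VolumesSummands` (Team B's `SummandPieces.PreservesRegions`, the (Ind2)-shape on a summand container) and c312-1's toy
log-shells `toyShells` (via `Cor312TeamAGapWitness`, whose `GapWitness.univ_not_subset_zero` supplies a nonzero packet vector).

* F-1913 `EtaData.SuitableInHull` — refuted at `{strictModel with hull := ptRegion}` (the one suitable output region `univ` is not inside
  `{true}`); inhabited by `RssChecks.strictModel_suitableInHull` (by name).
* F-2623 `SummandPieces.PreservesRegions` — refuted by the CONSTANT self-map of a container with one summand of carrier `Bool` (not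
  injective, hence not bijective); inhabited by the identity self-map of the same container.

HONEST FRAMING: a refuted ∀-closure says only that the SCHEMA over the free signature is not a theorem at toy data; nothing here bears on
the LANA report, Dupuy–Hilado, [IUTchIII] Thm. 3.11 / Cor. 3.12, and no side is taken on any author. A FACT row is an assumption label on
OUR typed statement; typed ≠ proved. [cite: LANA2026Report, §8.1 (f) p. 41]
-/

noncomputable section

namespace Summit.ABC

namespace IUTFork

namespace SchemaClosures

open MeasureTheory Thm311 Cor312 Cor312.Checks Cor312Vol RssChecks

/-! ## F-1913 `EtaData.SuitableInHull` (LANA §8.1 (f): every suitable output region lies in the hull) -/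

/-- **F-1913, ∀-closure REFUTED**: the η-datum `strictModel` of `LanaRssChecks` with its hull replaced by the one-point region
`{true}`: the suitable output region `LGP·S = univ` is not contained in it. [cite: LANA2026Report, §8.1 (f) p. 41] -/
theorem not_forall_suitableInHull :
    ¬ ∀ (Ω : Type) [MeasurableSpace Ω] (μ : Measure Ω) (E : EtaData μ), E.SuitableInHull := by
  intro h
  let E : EtaData μ₂ := { strictModel with hull := ptRegion }
  have h1 := h Bool μ₂ E allRegion (Set.mem_singleton _)
  have hf : false ∈ (Set.univ : Set Bool) := Set.mem_univ _
  have : false ∈ ({true} : Set Bool) := h1 hf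
  simp at this

/-- **F-1913, INHABITED**: `RssChecks.strictModel_suitableInHull` (hull = everything), by name. [cite: LANA2026Report, §8.1 (f) p. 41] -/
theorem exists_suitableInHull :
    ∃ (Ω : Type) (_ : MeasurableSpace Ω) (μ : Measure Ω) (E : EtaData μ), E.SuitableInHull :=
  ⟨Bool, inferInstance, μ₂, strictModel, strictModel_suitableInHull⟩

/-! ## F-2623 `SummandPieces.PreservesRegions` (the (Ind2)-shape on a summand container) -/

/-- **A two-point summand container over c312-1's toy log-shells**: one summand of carrier `Bool` at every `(j, v_ℚ)`, admissible
regions = the nonempty ones, log-measure `0`, weight `0`, and the surjection `packet → Bool`, `x ↦ [x = 0]` (the packet has a nonzero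
vector, `GapWitness.univ_not_subset_zero`). [folklore] -/
private theorem exists_boolPieces :
    ∃ V : SummandPieces toyShells, ∀ j vQ, (V.E j vQ = Unit) ∧ ∀ e : V.E j vQ, V.X j vQ e = Bool := by
  classical
  have hsurj : ∀ (j : toyIndex.Label) (vQ : toyIndex.VQ),
      Function.Surjective (fun (x : toyShells.Packet j vQ) (_ : Unit) => decide (x = 0)) := by
    intro j vQ f
    cases hb : f () with
    | true => exact ⟨0, funext fun u => by cases u; rw [hb]; simp⟩
    | false =>
      obtain ⟨x, -, hx⟩ := Set.not_subset.mp (GapWitness.univ_not_subset_zero j vQ)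
      exact ⟨x, funext fun u => by cases u; rw [hb]; simpa using hx⟩
  let V : SummandPieces toyShells :=
    { E := fun _ _ => Unit
      X := fun _ _ _ => Bool
      adm := fun _ _ _ R => R.Nonempty
      logμ := fun _ _ _ _ => 0
      adm_nonempty := fun _ _ _ _ h => h
      logμ_mono := fun _ _ _ _ _ _ _ _ => le_rfl
      e := fun j vQ x _ => decide (x = 0)
      e_surjective := hsurj
      w := fun _ _ _ => 0
      w_nonneg := fun _ _ _ => le_rfl }
  exact ⟨V, fun _ _ => ⟨rfl, fun _ => rfl⟩⟩

/-- **F-2623, ∀-closure REFUTED**: on the two-point container the CONSTANT self-map `_ ↦ (e ↦ true)` is not injective (it identifies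
`e ↦ true` and `e ↦ false`), hence not bijective, so it does not «preserve regions». (Instance forms by name: `summandwise`, `comp`.)
[claim: Mochizuki2012, status: disputed] -/
theorem not_forall_preservesRegions :
    ¬ ∀ (T : ThetaIndex) (L : LogShells T) (V : SummandPieces L) (j : T.Label) (vQ : T.VQ)
        (Ψ : (∀ e, V.X j vQ e) → ∀ e, V.X j vQ e), V.PreservesRegions j vQ Ψ := by
  intro h
  obtain ⟨V, hV⟩ := exists_boolPieces
  obtain ⟨hE, hX⟩ := hV 0 ()
  -- two distinct points of the product carrier
  let t : ∀ e, V.X 0 () e := fun e => cast (hX e).symm true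
  let f : ∀ e, V.X 0 () e := fun e => cast (hX e).symm false
  have htf : t ≠ f := by
    intro htf
    have e0 : V.E 0 () := cast hE.symm ()
    have := congrFun htf e0
    simp only [t, f] at this
    have key : ∀ (β : Type) (hβ : β = Bool), cast hβ.symm true = cast hβ.symm false → False := by
      rintro β rfl h'; simp at h'
    exact key _ (hX e0) this
  have hinj := (h toyIndex toyShells V 0 () (fun _ => t)).bijective.1
  exact htf (hinj (rfl : (fun _ => t) t = (fun _ => t) f))

/-- **F-2623, INHABITED**: the identity self-map of the two-point container preserves regions (every product region is its own image
and preimage). [claim: Mochizuki2012, status: disputed] -/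
theorem exists_preservesRegions :
    ∃ (T : ThetaIndex) (L : LogShells T) (V : SummandPieces L) (j : T.Label) (vQ : T.VQ)
        (Ψ : (∀ e, V.X j vQ e) → ∀ e, V.X j vQ e), V.PreservesRegions j vQ Ψ := by
  obtain ⟨V, -⟩ := exists_boolPieces
  exact ⟨toyIndex, toyShells, V, 0, (), id, Function.bijective_id,
    fun R hR => ⟨R, by rw [Set.image_id], hR, rfl⟩, fun R hR => ⟨R, by rw [Set.preimage_id], hR, rfl⟩⟩

end SchemaClosures

end IUTFork

end Summit.ABC

end
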